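import Summits.QuantumFields.YangMills.Theorems.UnitScaleTiltProp7SymFrameAnalytic
import Summits.QuantumFields.YangMills.Theorems.UnitScaleTiltProp7SymFrameCovariance
import Summits.QuantumFields.YangMills.Theorems.UnitScaleTiltProp7SymAvgTwSymDefs
import Summits.QuantumFields.YangMills.Theorems.UnitScaleTiltProp7AnalyticRemainderInputs
import HarnessLib

/-!
# Route `UnitScaleTilt`, crux K1 child «MinimiserStabilityRegPr» (stmt-QuantumFields-19200), skeleton v10 stub EX, route (α) — brick W4 (OWNER RULING g26-№12
# (T-sym-frames), ACK 25 (2)), PART 2∕2: **THE SYMMETRIC ACCUMULATED FRAME IS ANALYTIC ON THE FRAME-CHART BALL; `hr` OF THE SYM-FRAME BRIDGE; THE CAUCHY ROW `‖r y‖ ≤ 8∕R`**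

The twin, for the frames of record `frameTwS` (✓`Prop7SymAvgTwSym`, [Balaban1985Averaging] (82)∕(97) built on the route's own centred stair family), of ✓`Prop7SymAvgTwFrameDiff` ∕
✓`Prop7SymAvgTwFrameBound` (the corner-comb `vcov` frames of the (T) layer):

* §1 `analyticAt_coe_frameAccU_of_plaqSmall` — at a curved plaquette-small SU(2) background (`PlaqSmall a₀ U₀`, any `P`), the accumulated frame `A ↦ v_k(U₀♭, e^{A}U₀♭)(y)` is
  analytic at every `A₀` of the sup-ball `‖A₀(b)‖ ≤ t ≤ 1` AND within `6ℓLᵏ(2t + 30ℓs_B)` of `1`, `s_B = 2d(3Lᵏ−1)a₀`, under W2's budgets: cluster axial gauge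
  `u = axialT U₀ (embIter k y)` (✓`IterPlaqSmallAllL.dist1_axial_cluster_le`), part 1's analyticity for the gauged family `(e^{A}U₀♭)^{û}` (bondwise entire), un-gauging by W0
  ✓`Prop7SymFrameCovariance.frameAccU_gaugeActT` ∕ `norm_frameAccU_gaugeActT_sub_one` («w_sym under fine gauge maps is conjugation at the centre»);
* §2 the T³ letters at a printed-regular background `RegPr F n K ε₀ U₀` with the k-UNIFORM windows `10¹²L³ε₀ ≤ 1`, `10⁹L²e ≤ 1` (what W2's budget
  `8(16C₁+2)ℓ²Lᵏ(2t + 30ℓs_B) ≤ 1` costs at W1's constants `C₁ = 22100`, `ℓ = 5L`, `Lᵏs_B ≤ 18ε₀`, `Lᵏt = e`): ★`analyticAt_frameTwS_of_regPr` (analytic at every `A₀` with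
  `‖A₀(b)‖ ≤ e·η`, and `‖frameTwS U₀ A₀ y − 1‖ ≤ 30L(2e + 2700Lε₀)`), ★`hasFDerivAt_frameTwS_of_regPr` (the displayed `hr` of ✓`Prop7SymAvgTwSymBridge.hasFDerivAt_logChartTwS` ∕
  `QTwS_eq_QSym_sub`), ★★`norm_fderiv_frameTwS_le_of_regPr` — `‖fderiv (A ↦ frameTwS U₀ A y) 0 A‖ ≤ (8∕(e·η))·‖A‖`, Cauchy's `4M∕R` at `M = 2`, `R = e·η`
  (✓`Prop7AnalyticRemainderInputs.norm_fderiv_le_of_bound`); η-order `C_r = 8∕(eη) ~ η⁻¹`, as for (T).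

Cell `ym3-torus`, seat ym-ust-20520-w3 (gen 4); def-free; YM₃ on T³ is rung R3, not the Clay problem; count-neutral toward stmt-QuantumFields-19200.

References: T. Bałaban, CMP **98** (1985) 17–51 [Balaban1985Averaging] ((11)–(12) p.19, (82) p.30, (97) p.32, Prop. 4 (134)–(135) p.38, (159)–(163) p.42); CMP **102** (1985)
277–309 [Balaban1985Variational] ((7) p.278, (46) p.285); CMP **99** (1985) 389–434 [Balaban1985BackgroundPropagators] ((3.14) p.393); CMP **109** (1987) 249–301
[Balaban1987RG1] ((0.4)–(0.11) p.253).
-/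

noncomputable section

open Literature.MathematicalPhysics.QuantumFieldTheory.Balaban1983to89
open T4Continuum BlockAveraging AveragingRT ExpMeanLog
open B5Eq118OneStroke (iterBlockOf iterBlockOf_succ iterBlockOf_zero)
open NormedSpace
open B15DeterminingSets (embIter)
open B7Prop1Explicit (expUnit val_expUnit)
open B10Eq27TorusAxialLog (holT holT_nil gaugeActT gaugeActT_apply axialT unitsField toUField suIncl)
open Summit.QuantumFields.YangMills.Theorems.Prop8Chart (coe_unitsField_toUField)
open Summit.QuantumFields.YangMills.Theorems.Prop8Chart (loopHolU emlAvgU coe_emlAvgU emlIterU emlIterU_zero emlIterU_succ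
  norm_loopHolU_sub_one_lt_one two_block_of_mem_loopWalk exists_eq_line_of_mem_walk norm_emlIterU_sub_one_le_of_reads)
open Summit.QuantumFields.YangMills.Theorems.Prop7SymFrameIterSmall (diff_frameAccU_le_of_reads)


/-! ## W4 §1 — generic analyticity of the covariant double-bar tower and of the accumulated symmetric frames -/

namespace Summit.QuantumFields.YangMills.Theorems.Prop7SymFrameBound

open Summit.QuantumFields.YangMills.Theorems.Prop7SymAvgTwSym (vframeCovU dbarCovU dbarCovIterU frameAccU)

variable {P : Params}

/-! ## §1 — the SU(2) background: analyticity of the accumulated symmetric frame on the sup-ball, at a curved plaquette-small background -/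

section SU2

open scoped Matrix.Norms.L2Operator
open Summit.QuantumFields.YangMills.Theorems.Prop7SymAvgRelativeBound (norm_coe_toUnits_suIncl norm_coe_toUnits_suIncl_inv unitsField_toUField_gaugeActT
  gaugeActT_mul_bg)
open Summit.QuantumFields.YangMills.Theorems.IterPlaqSmallAllL (dist1_axial_cluster_le)
open Summit.QuantumFields.YangMills.Theorems.Prop7SymFrameCovariance (frameAccU_gaugeActT norm_frameAccU_gaugeActT_sub_one)

/-- ★★★ **W4 §3 — THE ACCUMULATED SYMMETRIC COVARIANT FRAME `A ↦ v_k(U₀♭, e^{A}U₀♭)(y)` IS ANALYTIC AT EVERY `A₀` OF THE SUP-BALL `‖A₀(b)‖ ≤ t ≤ 1`, AT A CURVED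
PLAQUETTE-SMALL SU(2) BACKGROUND** (`PlaqSmall a₀ U₀`, `k + 1 ≤ m + K`; `s_B := 2d(3Lᵏ − 1)a₀`; budgets `6400ℓ²Lᵏs_B ≤ 1`, `8(16C₁+2)ℓ²·Lᵏ(2t + 30ℓs_B) ≤ 1`,
`16ℓ(2Lᵏ(2t + 30ℓs_B) + 30ℓLᵏs_B) ≤ 1`; the one-step rows `hstep`∕`hframe` of W2 displayed).  Cluster axial gauge `u = axialT U₀ (embIter k y)` (background reads `≤ s_B`
under the block of `y`, ✓`dist1_axial_cluster_le`), difference reads `‖e^{A₀(b)} − 1‖ ≤ 2t`, §2 for the gauged family `A ↦ (e^{A}U₀♭)^{û}` (bondwise entire), and the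
un-gauging `v_k(y) = û^{(k)}(y)⁻¹·v_k^{gauged}(y)·û^{(k)}(y)` (W0 ✓`Prop7SymFrameCovariance.frameAccU_gaugeActT`).
[cite: Balaban1985Averaging, (97) p.32, (159)-(163) p.42, (11)-(12) p.19, Prop. 4 (134)-(135) p.38; Balaban1987RG1, (0.4)-(0.11) p.253] -/
theorem analyticAt_coe_frameAccU_of_plaqSmall {C₁ : ℝ} (hC₁ : 2 ≤ C₁)
    (hstep : ∀ (j : ℕ), j + 1 ≤ P.m + P.K → ∀ (U₀ W : GaugeField P j (Matrix (Fin 2) (Fin 2) ℂ)ˣ) (c : PBond P (j + 1)) (s₀ s₁ δ : ℝ),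
      0 ≤ s₀ → 0 ≤ s₁ → 0 ≤ δ → 120 * (((P.d + 2) * P.L : ℕ) : ℝ) * (s₀ + s₁) ≤ 1 →
      (∀ b : PBond P j, (blockOf b.src = c.src ∨ blockOf b.src = c.tgt) → (blockOf b.tgt = c.src ∨ blockOf b.tgt = c.tgt) →
        ‖((U₀ b : (Matrix (Fin 2) (Fin 2) ℂ)ˣ) : Matrix (Fin 2) (Fin 2) ℂ) - 1‖ ≤ s₀ ∧ ‖((W b : (Matrix (Fin 2) (Fin 2) ℂ)ˣ) : Matrix (Fin 2) (Fin 2) ℂ) - 1‖ ≤ s₁ ∧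
          ‖((W b : (Matrix (Fin 2) (Fin 2) ℂ)ˣ) : Matrix (Fin 2) (Fin 2) ℂ) - ((U₀ b : (Matrix (Fin 2) (Fin 2) ℂ)ˣ) : Matrix (Fin 2) (Fin 2) ℂ)‖ ≤ δ) →
      ‖((dbarCovU U₀ W c : (Matrix (Fin 2) (Fin 2) ℂ)ˣ) : Matrix (Fin 2) (Fin 2) ℂ) * (((emlAvgU U₀ c)⁻¹ : (Matrix (Fin 2) (Fin 2) ℂ)ˣ) : Matrix (Fin 2) (Fin 2) ℂ) - 1‖ ≤
        (P.L : ℝ) * δ + C₁ * (((P.d + 2) * P.L : ℕ) : ℝ) ^ 2 * (s₀ + s₁) ^ 2)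
    (hframe : ∀ (j : ℕ), j + 1 ≤ P.m + P.K → ∀ (U₀ W : GaugeField P j (Matrix (Fin 2) (Fin 2) ℂ)ˣ) (y : Site P (j + 1)) (s₀ s₁ δ : ℝ),
      0 ≤ s₀ → 0 ≤ s₁ → 0 ≤ δ → 120 * (((P.d + 2) * P.L : ℕ) : ℝ) * (s₀ + s₁) ≤ 1 →
      (∀ b : PBond P j, blockOf b.src = y → blockOf b.tgt = y →
        ‖((U₀ b : (Matrix (Fin 2) (Fin 2) ℂ)ˣ) : Matrix (Fin 2) (Fin 2) ℂ) - 1‖ ≤ s₀ ∧ ‖((W b : (Matrix (Fin 2) (Fin 2) ℂ)ˣ) : Matrix (Fin 2) (Fin 2) ℂ) - 1‖ ≤ s₁ ∧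
          ‖((W b : (Matrix (Fin 2) (Fin 2) ℂ)ˣ) : Matrix (Fin 2) (Fin 2) ℂ) - ((U₀ b : (Matrix (Fin 2) (Fin 2) ℂ)ˣ) : Matrix (Fin 2) (Fin 2) ℂ)‖ ≤ δ) →
      ‖((vframeCovU U₀ W y : (Matrix (Fin 2) (Fin 2) ℂ)ˣ) : Matrix (Fin 2) (Fin 2) ℂ) - 1‖ ≤
        (((P.d + 2) * P.L : ℕ) : ℝ) * δ + C₁ * (((P.d + 2) * P.L : ℕ) : ℝ) ^ 2 * (s₀ + s₁) ^ 2)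
    {k : ℕ} (hk : k + 1 ≤ P.m + P.K) (U₀ : GaugeField P 0 (Matrix.specialUnitaryGroup (Fin 2) ℂ)) {a₀ : ℝ} (ha₀ : 0 < a₀) (hU : PlaqSmall a₀ U₀)
    (A₀ : PBond P 0 → Matrix (Fin 2) (Fin 2) ℂ) {t : ℝ} (ht0 : 0 ≤ t) (ht1 : t ≤ 1) (hA : ∀ b, ‖A₀ b‖ ≤ t)
    (hbud₀ : 6400 * (((P.d + 2) * P.L : ℕ) : ℝ) ^ 2 * (P.L : ℝ) ^ k * (2 * ((P.d : ℝ) * (3 * (P.L : ℝ) ^ k - 1)) * a₀) ≤ 1)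
    (hbud : 8 * (16 * C₁ + 2) * (((P.d + 2) * P.L : ℕ) : ℝ) ^ 2 *
      ((P.L : ℝ) ^ k * (2 * t + 30 * (((P.d + 2) * P.L : ℕ) : ℝ) * (2 * ((P.d : ℝ) * (3 * (P.L : ℝ) ^ k - 1)) * a₀))) ≤ 1)
    (hρ : 16 * (((P.d + 2) * P.L : ℕ) : ℝ) *
      (2 * ((P.L : ℝ) ^ k * (2 * t + 30 * (((P.d + 2) * P.L : ℕ) : ℝ) * (2 * ((P.d : ℝ) * (3 * (P.L : ℝ) ^ k - 1)) * a₀))) +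
        30 * (((P.d + 2) * P.L : ℕ) : ℝ) * (P.L : ℝ) ^ k * (2 * ((P.d : ℝ) * (3 * (P.L : ℝ) ^ k - 1)) * a₀)) ≤ 1)
    (y : Site P k) :
    AnalyticAt ℂ (fun A : PBond P 0 → Matrix (Fin 2) (Fin 2) ℂ =>
      ((frameAccU k (unitsField (toUField U₀)) (fun b => expUnit (A b) * unitsField (toUField U₀) b) y : (Matrix (Fin 2) (Fin 2) ℂ)ˣ) :
        Matrix (Fin 2) (Fin 2) ℂ)) A₀ ∧
    ‖((frameAccU k (unitsField (toUField U₀)) (fun b => expUnit (A₀ b) * unitsField (toUField U₀) b) y : (Matrix (Fin 2) (Fin 2) ℂ)ˣ) :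
        Matrix (Fin 2) (Fin 2) ℂ) - 1‖ ≤
      6 * (((P.d + 2) * P.L : ℕ) : ℝ) * ((P.L : ℝ) ^ k * (2 * t + 30 * (((P.d + 2) * P.L : ℕ) : ℝ) * (2 * ((P.d : ℝ) * (3 * (P.L : ℝ) ^ k - 1)) * a₀))) := by
  set sB : ℝ := 2 * ((P.d : ℝ) * (3 * (P.L : ℝ) ^ k - 1)) * a₀ with hsB
  set u : GaugeTransf P 0 (Matrix.specialUnitaryGroup (Fin 2) ℂ) := axialT U₀ (embIter k y) with hu
  set û : GaugeTransf P 0 (Matrix (Fin 2) (Fin 2) ℂ)ˣ := fun x => Unitary.toUnits (suIncl (u x)) with hû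
  set V₂ : GaugeField P 0 (Matrix (Fin 2) (Fin 2) ℂ)ˣ := unitsField (toUField U₀) with hV₂
  have hL1 : (1 : ℝ) ≤ P.L := by exact_mod_cast P.L_pos
  have hsB0 : 0 ≤ sB := by
    rw [hsB]
    have h3 : (0 : ℝ) ≤ 3 * (P.L : ℝ) ^ k - 1 := by linarith [one_le_pow₀ (n := k) hL1]
    positivity
  -- the gauged family and background
  set Fam : (PBond P 0 → Matrix (Fin 2) (Fin 2) ℂ) → GaugeField P 0 (Matrix (Fin 2) (Fin 2) ℂ)ˣ :=
    fun A => gaugeActT û (fun b => expUnit (A b) * V₂ b) with hFam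
  have hF0 : ∀ b : PBond P 0, AnalyticAt ℂ (fun A => ((Fam A b : (Matrix (Fin 2) (Fin 2) ℂ)ˣ) : Matrix (Fin 2) (Fin 2) ℂ)) A₀ :=
    fun b => analyticAt_coe_gaugeActT_expUnit_mul û V₂ b A₀
  -- reads under the block of `y` in the cluster axial gauge
  have hreads : ∀ b : PBond P 0, iterBlockOf k b.src ∈ ({w | w = y} : Set (Site P k)) → iterBlockOf k b.tgt ∈ ({w | w = y} : Set (Site P k)) →
      ‖((gaugeActT û V₂ b : (Matrix (Fin 2) (Fin 2) ℂ)ˣ) : Matrix (Fin 2) (Fin 2) ℂ) - 1‖ ≤ sB ∧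
        ‖((Fam A₀ b : (Matrix (Fin 2) (Fin 2) ℂ)ˣ) : Matrix (Fin 2) (Fin 2) ℂ) - ((gaugeActT û V₂ b : (Matrix (Fin 2) (Fin 2) ℂ)ˣ) : Matrix (Fin 2) (Fin 2) ℂ)‖ ≤ 2 * t := by
    intro b hbs hbt
    have hB : ‖((gaugeActT û V₂ b : (Matrix (Fin 2) (Fin 2) ℂ)ˣ) : Matrix (Fin 2) (Fin 2) ℂ) - 1‖ ≤ sB := by
      rw [hû, hV₂, ← unitsField_toUField_gaugeActT, coe_unitsField_toUField, ← SU2Mean.dist1_eq_norm, hu]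
      exact dist1_axial_cluster_le hk U₀ ha₀ hU y b.dir b.dir b (Or.inl hbs) (Or.inl hbt)
    refine ⟨hB, ?_⟩
    -- `(e^{A}V)^{û}(b) − V^{û}(b) = û(b₋)(e^{A(b)} − 1)û(b₋)⁻¹ · V^{û}(b)`
    have hG1 : ‖((gaugeActT û V₂ b : (Matrix (Fin 2) (Fin 2) ℂ)ˣ) : Matrix (Fin 2) (Fin 2) ℂ)‖ ≤ 1 := by
      rw [gaugeActT_apply, Units.val_mul, Units.val_mul]
      calc _ ≤ ‖((û b.src : (Matrix (Fin 2) (Fin 2) ℂ)ˣ) : Matrix (Fin 2) (Fin 2) ℂ) * ((V₂ b : (Matrix (Fin 2) (Fin 2) ℂ)ˣ) : Matrix (Fin 2) (Fin 2) ℂ)‖ *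
            ‖(((û b.tgt)⁻¹ : (Matrix (Fin 2) (Fin 2) ℂ)ˣ) : Matrix (Fin 2) (Fin 2) ℂ)‖ := norm_mul_le _ _
        _ ≤ (‖((û b.src : (Matrix (Fin 2) (Fin 2) ℂ)ˣ) : Matrix (Fin 2) (Fin 2) ℂ)‖ * ‖((V₂ b : (Matrix (Fin 2) (Fin 2) ℂ)ˣ) : Matrix (Fin 2) (Fin 2) ℂ)‖) * 1 := by
            gcongr
            · exact norm_mul_le _ _
            · exact (norm_coe_toUnits_suIncl_inv (u b.tgt)).le
        _ ≤ (1 * 1) * 1 := by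
            gcongr
            · exact (norm_coe_toUnits_suIncl (u b.src)).le
            · rw [hV₂, coe_unitsField_toUField]; exact (Summit.QuantumFields.YangMills.Theorems.Prop8Criticality.norm_coe_su2 (U₀ b)).le
        _ = 1 := by norm_num
    have hE : ‖((expUnit (A₀ b) : (Matrix (Fin 2) (Fin 2) ℂ)ˣ) : Matrix (Fin 2) (Fin 2) ℂ) - 1‖ ≤ 2 * t := by
      rw [val_expUnit]
      exact (B7TransferAnalyticMean.norm_exp_sub_one_le_two_mul ((hA b).trans ht1)).trans (by linarith [hA b])
    have hval : ((Fam A₀ b : (Matrix (Fin 2) (Fin 2) ℂ)ˣ) : Matrix (Fin 2) (Fin 2) ℂ) - ((gaugeActT û V₂ b : (Matrix (Fin 2) (Fin 2) ℂ)ˣ) : Matrix (Fin 2) (Fin 2) ℂ) =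
        (((û b.src : (Matrix (Fin 2) (Fin 2) ℂ)ˣ) : Matrix (Fin 2) (Fin 2) ℂ) * (((expUnit (A₀ b) : (Matrix (Fin 2) (Fin 2) ℂ)ˣ) : Matrix (Fin 2) (Fin 2) ℂ) - 1) *
          (((û b.src)⁻¹ : (Matrix (Fin 2) (Fin 2) ℂ)ˣ) : Matrix (Fin 2) (Fin 2) ℂ)) * ((gaugeActT û V₂ b : (Matrix (Fin 2) (Fin 2) ℂ)ˣ) : Matrix (Fin 2) (Fin 2) ℂ) := by
      rw [hFam]
      simp only []
      rw [gaugeActT_mul_bg, Units.val_mul, Units.val_mul, Units.val_mul]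
      rw [mul_sub, sub_mul, sub_mul, mul_one, Units.mul_inv, one_mul]
    rw [hval]
    calc _ ≤ ‖((û b.src : (Matrix (Fin 2) (Fin 2) ℂ)ˣ) : Matrix (Fin 2) (Fin 2) ℂ) * (((expUnit (A₀ b) : (Matrix (Fin 2) (Fin 2) ℂ)ˣ) : Matrix (Fin 2) (Fin 2) ℂ) - 1) *
          (((û b.src)⁻¹ : (Matrix (Fin 2) (Fin 2) ℂ)ˣ) : Matrix (Fin 2) (Fin 2) ℂ)‖ * ‖((gaugeActT û V₂ b : (Matrix (Fin 2) (Fin 2) ℂ)ˣ) : Matrix (Fin 2) (Fin 2) ℂ)‖ :=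
          norm_mul_le _ _
      _ ≤ (‖((û b.src : (Matrix (Fin 2) (Fin 2) ℂ)ˣ) : Matrix (Fin 2) (Fin 2) ℂ) * (((expUnit (A₀ b) : (Matrix (Fin 2) (Fin 2) ℂ)ˣ) : Matrix (Fin 2) (Fin 2) ℂ) - 1)‖ *
          ‖(((û b.src)⁻¹ : (Matrix (Fin 2) (Fin 2) ℂ)ˣ) : Matrix (Fin 2) (Fin 2) ℂ)‖) * 1 := by
          gcongr
          exact norm_mul_le _ _
      _ ≤ ((‖((û b.src : (Matrix (Fin 2) (Fin 2) ℂ)ˣ) : Matrix (Fin 2) (Fin 2) ℂ)‖ * ‖((expUnit (A₀ b) : (Matrix (Fin 2) (Fin 2) ℂ)ˣ) : Matrix (Fin 2) (Fin 2) ℂ) - 1‖) * 1) * 1 := by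
          gcongr
          · exact norm_mul_le _ _
          · exact (norm_coe_toUnits_suIncl_inv (u b.src)).le
      _ ≤ ((1 * (2 * t)) * 1) * 1 := by
          gcongr
          exact (norm_coe_toUnits_suIncl (u b.src)).le
      _ = 2 * t := by ring
  -- §2 for the gauged pair, at the top level, under the block of `y`
  have h2t : 0 ≤ 2 * t := by positivity
  obtain ⟨-, hΦ⟩ := analyticAt_coe_dbarCovIterU_frameAccU_of_reads hC₁ hstep hframe Fam A₀ hF0 (gaugeActT û V₂) (Nat.le_of_succ_le hk) hsB0 h2t
    hbud₀ hbud hρ k le_rfl {w | w = y} hreads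
  have han := hΦ y rfl
  -- W2's frame row for the gauged pair, read back through the unitary conjugation (W0)
  have hgb := (diff_frameAccU_le_of_reads hC₁ hstep hframe k (Nat.le_of_succ_le hk) {w | w = y} (gaugeActT û V₂) (Fam A₀) sB (2 * t) hsB0 h2t
    hbud₀ hbud hreads).2 y rfl
  have hU1 : ∀ (i : ℕ) (z : Site P i), transfUp û i z ∈ B7Prop1Explicit.U1 (Matrix (Fin 2) (Fin 2) ℂ) := by
    intro i
    induction i with
    | zero => intro z; exact B7Prop1Explicit.mem_U1.mpr ⟨(norm_coe_toUnits_suIncl (u z)).le, (norm_coe_toUnits_suIncl_inv (u z)).le⟩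
    | succ i ih => intro z; exact ih (emb z)
  have hbound : ‖((frameAccU k V₂ (fun b => expUnit (A₀ b) * V₂ b) y : (Matrix (Fin 2) (Fin 2) ℂ)ˣ) : Matrix (Fin 2) (Fin 2) ℂ) - 1‖ ≤
      6 * (((P.d + 2) * P.L : ℕ) : ℝ) * ((P.L : ℝ) ^ k * (2 * t + 30 * (((P.d + 2) * P.L : ℕ) : ℝ) * sB)) := by
    rw [← norm_frameAccU_gaugeActT_sub_one (transfUp û) (fun _ _ => rfl) hU1 V₂ (fun b => expUnit (A₀ b) * V₂ b) k y]
    exact hgb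
  refine ⟨?_, hbound⟩
  -- un-gauging: `v_k(y) = û^{(k)}(y)⁻¹ · v_k^{gauged}(y) · û^{(k)}(y)`
  have hfun : (fun A : PBond P 0 → Matrix (Fin 2) (Fin 2) ℂ =>
      ((frameAccU k V₂ (fun b => expUnit (A b) * V₂ b) y : (Matrix (Fin 2) (Fin 2) ℂ)ˣ) : Matrix (Fin 2) (Fin 2) ℂ)) =
      fun A => (((transfUp û k y)⁻¹ : (Matrix (Fin 2) (Fin 2) ℂ)ˣ) : Matrix (Fin 2) (Fin 2) ℂ) *
        ((frameAccU k (gaugeActT û V₂) (Fam A) y : (Matrix (Fin 2) (Fin 2) ℂ)ˣ) : Matrix (Fin 2) (Fin 2) ℂ) *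
        ((transfUp û k y : (Matrix (Fin 2) (Fin 2) ℂ)ˣ) : Matrix (Fin 2) (Fin 2) ℂ) := by
    funext A
    have key : frameAccU k V₂ (fun b => expUnit (A b) * V₂ b) y =
        (transfUp û k y)⁻¹ * frameAccU k (gaugeActT û V₂) (Fam A) y * transfUp û k y := by
      have h := frameAccU_gaugeActT (transfUp û) (fun _ _ => rfl) V₂ (fun b => expUnit (A b) * V₂ b) k y
      rw [show gaugeActT (transfUp û 0) = gaugeActT û from rfl] at h
      rw [hFam]
      simp only []
      rw [h]; group
    have := congrArg (fun z : (Matrix (Fin 2) (Fin 2) ℂ)ˣ => (z : Matrix (Fin 2) (Fin 2) ℂ)) key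
    simpa only [Units.val_mul] using this
  rw [hfun]
  exact (analyticAt_const.mul han).mul analyticAt_const

end SU2

/-! ## §2 — THE T³ LETTERS AT A PRINTED-REGULAR BACKGROUND: analyticity on the frame-chart ball, the derivative at `0`, the Cauchy bound `‖r y‖ ≤ 8∕R` -/

section T3

open scoped Matrix.Norms.L2Operator
open Metric
open T3ContinuumYM3Torus
open T3PrintedRegularMinimiser (RegPr)
open T3LevelShift (siteShift)
open T3PrintedRegularOrbits (sites_eq)
open T3SectALandauChart (bgUnits eta eta_pos)
open T3RegularMinimiser (regThreshold)
open Summit.QuantumFields.YangMills.Theorems.Prop7SymAvgTwSym (frameTwS frameTwS_def)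
open Summit.QuantumFields.YangMills.Theorems.Prop7AnalyticRemainderInputs (norm_fderiv_le_of_bound)

variable (F : T3Family) {n K : ℕ} (h : n ≤ K)

/-- The route's `GL` background letter is the `SU(2)` field read in `M₂(ℂ)ˣ` (`rfl`; named for syntactic rewriting). [cite: Balaban1985Variational, (7) p.278] -/
theorem bgUnits_eq_unitsField (U₀ : GaugeField (F.P K) 0 (Matrix.specialUnitaryGroup (Fin 2) ℂ)) : bgUnits F K U₀ = unitsField (toUField U₀) := rfl

variable {F} in
/-- helper: the frame letter unfolded to the generic objects. [cite: Balaban1985Averaging, (97) p.32] -/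
theorem coe_frameTwS_eq (U₀ : GaugeField (F.P K) 0 (Matrix.specialUnitaryGroup (Fin 2) ℂ)) (A : PBond (F.P K) 0 → Matrix (Fin 2) (Fin 2) ℂ) (y : Site (F.P n) 0) :
    ((frameTwS F n K h U₀ A y : (Matrix (Fin 2) (Fin 2) ℂ)ˣ) : Matrix (Fin 2) (Fin 2) ℂ) =
      ((frameAccU (K - n) (unitsField (toUField U₀)) (fun b => expUnit (A b) * unitsField (toUField U₀) b) (siteShift (sites_eq F n K h) y) :
        (Matrix (Fin 2) (Fin 2) ℂ)ˣ) : Matrix (Fin 2) (Fin 2) ℂ) := by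
  rw [frameTwS_def]; rfl

/-- ★★★ **W4 — THE SYMMETRIC ACCUMULATED FRAME `A ↦ w_sym(A)(y) = frameTwS U₀ A y` IS ANALYTIC ON THE FRAME-CHART BALL AND CLOSE TO `1` THERE, AT A PRINTED-REGULAR
BACKGROUND**: for `RegPr F n K ε₀ U₀` with the k-UNIFORM windows `10¹²L³ε₀ ≤ 1`, `10⁹L²e ≤ 1` and every `A₀` with `‖A₀(b)‖ ≤ e·η` bondwise (`η = L^{−(K−n)}`):
`A ↦ frameTwS U₀ A y` is analytic at `A₀` and `‖frameTwS U₀ A₀ y − 1‖ ≤ 30L(2e + 2700Lε₀)` — §3 at the route's letters (`d = 3`, `ℓ = 5L`, `a₀ = ε₀L^{−2(K−n)}` from `RegPr`,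
`Lᵏ·s_B ≤ 18ε₀`, `Lᵏ·t = e`), W1's rows at `C₁ = 22100`.  (The two windows are what W2's budget `8(16C₁+2)ℓ²Lᵏ(2t + 30ℓs_B) ≤ 1` costs at these constants:
`1.42·10⁸L²e + 1.91·10¹¹L³ε₀ ≤ 1`.) [cite: Balaban1985Averaging, (97) p.32, (159)-(163) p.42, Prop. 4 p.38; Balaban1985Variational, (7) p.278, (46) p.285] -/
theorem analyticAt_frameTwS_of_regPr {ε₀ e : ℝ} (hε₀ : 0 < ε₀) (he : 0 ≤ e) (hε : 10 ^ 12 * (F.L : ℝ) ^ 3 * ε₀ ≤ 1) (he9 : 10 ^ 9 * (F.L : ℝ) ^ 2 * e ≤ 1)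
    (U₀ : GaugeField (F.P K) 0 (Matrix.specialUnitaryGroup (Fin 2) ℂ)) (hreg : RegPr F n K ε₀ U₀) (y : Site (F.P n) 0)
    {A₀ : PBond (F.P K) 0 → Matrix (Fin 2) (Fin 2) ℂ} (hA₀ : ∀ b, ‖A₀ b‖ ≤ e * eta F n K) :
    AnalyticAt ℂ (fun A : PBond (F.P K) 0 → Matrix (Fin 2) (Fin 2) ℂ => ((frameTwS F n K h U₀ A y : (Matrix (Fin 2) (Fin 2) ℂ)ˣ) : Matrix (Fin 2) (Fin 2) ℂ)) A₀ ∧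
      ‖((frameTwS F n K h U₀ A₀ y : (Matrix (Fin 2) (Fin 2) ℂ)ˣ) : Matrix (Fin 2) (Fin 2) ℂ) - 1‖ ≤ 30 * (F.L : ℝ) * (2 * e + 2700 * (F.L : ℝ) * ε₀) := by
  -- letters
  have hd : (F.P K).d = 3 := T3Family.P_d F K
  have hLn : (F.P K).L = F.L := rfl
  have hL3 : 3 ≤ F.L := by obtain ⟨a, ha⟩ := F.hL.1; have := F.hL.2; omega
  have hL3r : (3 : ℝ) ≤ F.L := by exact_mod_cast hL3
  have hL0 : (0 : ℝ) < F.L := by linarith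
  have hL1 : (1 : ℝ) ≤ F.L := by linarith
  have hk1 : K - n + 1 ≤ (F.P K).m + (F.P K).K := by
    show K - n + 1 ≤ F.m + K; have := F.hm; omega
  set X : ℝ := (F.L : ℝ) ^ (K - n) with hX
  have hX1 : 1 ≤ X := one_le_pow₀ hL1
  have hX0 : 0 < X := by positivity
  have hXη : X * eta F n K = 1 := by
    show (F.L : ℝ) ^ (K - n) * ((F.L : ℝ)⁻¹) ^ (K - n) = 1
    rw [inv_pow, mul_inv_cancel₀ (pow_ne_zero _ hL0.ne')]
  have hη0 : 0 < eta F n K := eta_pos F n K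
  set a₀ : ℝ := regThreshold F n K ε₀ with ha₀
  have ha₀0 : 0 < a₀ := by rw [ha₀]; unfold regThreshold; positivity
  have hXa : X * (X * a₀) = ε₀ := by
    have hX2 : X * X = (F.L : ℝ) ^ (2 * (K - n)) := by rw [hX, ← pow_add, two_mul]
    have ha : a₀ = ε₀ * ((F.L : ℝ) ^ (2 * (K - n)))⁻¹ := by rw [ha₀]; unfold regThreshold; rw [inv_pow]
    rw [← mul_assoc, hX2, ha, mul_comm ε₀, ← mul_assoc, mul_inv_cancel₀ (pow_ne_zero _ hL0.ne'), one_mul]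
  have hU : PlaqSmall a₀ U₀ := hreg.1
  -- reads `t = e·η`, `X·t = e`
  set t : ℝ := e * eta F n K with ht
  have ht0 : 0 ≤ t := by positivity
  have hXt : X * t = e := by rw [ht, mul_left_comm, hXη, mul_one]
  have he1 : e ≤ 1 := by nlinarith [mul_nonneg (by norm_num : (0 : ℝ) ≤ 10 ^ 9) (mul_nonneg (sq_nonneg (F.L : ℝ)) he)]
  have ht1 : t ≤ 1 := by
    have hη1 : eta F n K ≤ 1 := by
      have : eta F n K = X⁻¹ := eq_inv_of_mul_eq_one_right hXη
      rw [this]; exact inv_le_one_of_one_le₀ hX1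
    calc t = e * eta F n K := rfl
      _ ≤ 1 * 1 := mul_le_mul he1 hη1 hη0.le zero_le_one
      _ = 1 := one_mul 1
  -- `s_B` and `X·s_B ≤ 18ε₀`
  set sB : ℝ := 2 * (((3 : ℕ) : ℝ) * (3 * X - 1)) * a₀ with hsB
  have hsB0 : 0 ≤ sB := by
    rw [hsB]; have : (0 : ℝ) ≤ 3 * X - 1 := by linarith
    positivity
  have hXsB : X * sB ≤ 18 * ε₀ := by
    rw [hsB, ← hXa]; push_cast; nlinarith [mul_nonneg hX0.le ha₀0.le]
  have hXsB0 : 0 ≤ X * sB := mul_nonneg hX0.le hsB0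
  -- the three budgets of §3 at `d = 3`, `ℓ = 5L`, `C₁ = 22100`
  have hℓ : ((((3 : ℕ) + 2) * F.L : ℕ) : ℝ) = 5 * F.L := by push_cast; ring
  have hε' : (F.L : ℝ) ^ 3 * ε₀ ≤ 1 / 10 ^ 12 := by
    rw [le_div_iff₀ (by positivity)]; linarith
  have he' : (F.L : ℝ) ^ 2 * e ≤ 1 / 10 ^ 9 := by
    rw [le_div_iff₀ (by positivity)]; linarith
  have hL23 : (F.L : ℝ) ^ 2 ≤ (F.L : ℝ) ^ 3 := pow_le_pow_right₀ hL1 (by norm_num)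
  have hL12 : (F.L : ℝ) ≤ (F.L : ℝ) ^ 2 := by nlinarith
  have hL2ε : (F.L : ℝ) ^ 2 * ε₀ ≤ (F.L : ℝ) ^ 3 * ε₀ := mul_le_mul_of_nonneg_right hL23 hε₀.le
  have hLe : (F.L : ℝ) * e ≤ (F.L : ℝ) ^ 2 * e := mul_le_mul_of_nonneg_right hL12 he
  have hbud₀ : 6400 * ((((3 : ℕ) + 2) * F.L : ℕ) : ℝ) ^ 2 * X * sB ≤ 1 := by
    rw [hℓ]
    have : 6400 * (5 * (F.L : ℝ)) ^ 2 * X * sB = 160000 * (F.L : ℝ) ^ 2 * (X * sB) := by ring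
    rw [this]; nlinarith [sq_nonneg (F.L : ℝ)]
  have hbud : 8 * (16 * (22100 : ℝ) + 2) * ((((3 : ℕ) + 2) * F.L : ℕ) : ℝ) ^ 2 * (X * (2 * t + 30 * ((((3 : ℕ) + 2) * F.L : ℕ) : ℝ) * sB)) ≤ 1 := by
    rw [hℓ]
    have : 8 * (16 * (22100 : ℝ) + 2) * (5 * (F.L : ℝ)) ^ 2 * (X * (2 * t + 30 * (5 * (F.L : ℝ)) * sB)) =
        141440800 * (F.L : ℝ) ^ 2 * (X * t) + 10608060000 * (F.L : ℝ) ^ 3 * (X * sB) := by ring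
    rw [this, hXt]; nlinarith [pow_nonneg hL0.le 3]
  have hρ : 16 * ((((3 : ℕ) + 2) * F.L : ℕ) : ℝ) *
      (2 * (X * (2 * t + 30 * ((((3 : ℕ) + 2) * F.L : ℕ) : ℝ) * sB)) + 30 * ((((3 : ℕ) + 2) * F.L : ℕ) : ℝ) * X * sB) ≤ 1 := by
    rw [hℓ]
    have : 16 * (5 * (F.L : ℝ)) * (2 * (X * (2 * t + 30 * (5 * (F.L : ℝ)) * sB)) + 30 * (5 * (F.L : ℝ)) * X * sB) =
        320 * (F.L : ℝ) * (X * t) + 36000 * (F.L : ℝ) ^ 2 * (X * sB) := by ring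
    rw [this, hXt]; nlinarith [sq_nonneg (F.L : ℝ)]
  -- §3 at the torus lattice `F.P K`
  have h3 := analyticAt_coe_frameAccU_of_plaqSmall (P := F.P K) (C₁ := 22100) (by norm_num) hstep_of_W1 hframe_of_W1 hk1 U₀ ha₀0 hU A₀ ht0 ht1 hA₀
    (by rw [hd, hLn, ← hX, ← hsB]; exact hbud₀) (by rw [hd, hLn, ← hX, ← hsB]; exact hbud) (by rw [hd, hLn, ← hX, ← hsB]; exact hρ)
    (siteShift (sites_eq F n K h) y)
  have hfin : 6 * (5 * (F.L : ℝ)) * (X * (2 * t + 30 * (5 * (F.L : ℝ)) * sB)) ≤ 30 * (F.L : ℝ) * (2 * e + 2700 * (F.L : ℝ) * ε₀) := by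
    have : 6 * (5 * (F.L : ℝ)) * (X * (2 * t + 30 * (5 * (F.L : ℝ)) * sB)) = 30 * (F.L : ℝ) * (2 * (X * t) + 150 * (F.L : ℝ) * (X * sB)) := by ring
    rw [this, hXt]
    have h150 : 150 * (F.L : ℝ) * (X * sB) ≤ 2700 * (F.L : ℝ) * ε₀ :=
      calc 150 * (F.L : ℝ) * (X * sB) ≤ 150 * (F.L : ℝ) * (18 * ε₀) := mul_le_mul_of_nonneg_left hXsB (by positivity)
        _ = 2700 * (F.L : ℝ) * ε₀ := by ring
    exact mul_le_mul_of_nonneg_left (by linarith) (by positivity)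
  have hfinP : 6 * ((((F.P K).d + 2) * (F.P K).L : ℕ) : ℝ) *
      (((F.P K).L : ℝ) ^ (K - n) * (2 * t + 30 * ((((F.P K).d + 2) * (F.P K).L : ℕ) : ℝ) * (2 * (((F.P K).d : ℝ) * (3 * ((F.P K).L : ℝ) ^ (K - n) - 1)) * a₀))) ≤
      30 * (F.L : ℝ) * (2 * e + 2700 * (F.L : ℝ) * ε₀) := by
    rw [hd, hLn, ← hX, ← hsB, hℓ]; exact hfin
  have hfun : (fun A : PBond (F.P K) 0 → Matrix (Fin 2) (Fin 2) ℂ => ((frameTwS F n K h U₀ A y : (Matrix (Fin 2) (Fin 2) ℂ)ˣ) : Matrix (Fin 2) (Fin 2) ℂ)) =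
      fun A => ((frameAccU (K - n) (unitsField (toUField U₀)) (fun b => expUnit (A b) * unitsField (toUField U₀) b) (siteShift (sites_eq F n K h) y) :
        (Matrix (Fin 2) (Fin 2) ℂ)ˣ) : Matrix (Fin 2) (Fin 2) ℂ) := by
    funext A; exact coe_frameTwS_eq h U₀ A y
  have hval : ((frameTwS F n K h U₀ A₀ y : (Matrix (Fin 2) (Fin 2) ℂ)ˣ) : Matrix (Fin 2) (Fin 2) ℂ) =
      ((frameAccU (K - n) (unitsField (toUField U₀)) (fun b => expUnit (A₀ b) * unitsField (toUField U₀) b) (siteShift (sites_eq F n K h) y) :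
        (Matrix (Fin 2) (Fin 2) ℂ)ˣ) : Matrix (Fin 2) (Fin 2) ℂ) := coe_frameTwS_eq h U₀ A₀ y
  rw [hfun, hval]
  exact ⟨h3.1, h3.2.trans hfinP⟩

/-- ★ **`hr` OF THE SYM-FRAME BRIDGE, DISCHARGED**: at a printed-regular background (`10¹²L³ε₀ ≤ 1`) the accumulated symmetric frame has
`HasFDerivAt (A ↦ frameTwS U₀ A y) (fderiv ℂ (A ↦ frameTwS U₀ A y) 0) 0` for every comparison site `y` (analyticity at `0`, the case `e = 0` of
`analyticAt_frameTwS_of_regPr`) — the displayed `hr` of ★w5-20520 g3's `Prop7SymAvgTwSymBridge.hasFDerivAt_logChartTwS` ∕ `QTwS_eq_QSym_sub`.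
[cite: Balaban1985Averaging, (97) p.32; Balaban1985BackgroundPropagators, (3.14) p.393] -/
theorem hasFDerivAt_frameTwS_of_regPr {ε₀ : ℝ} (hε₀ : 0 < ε₀) (hε : 10 ^ 12 * (F.L : ℝ) ^ 3 * ε₀ ≤ 1)
    (U₀ : GaugeField (F.P K) 0 (Matrix.specialUnitaryGroup (Fin 2) ℂ)) (hreg : RegPr F n K ε₀ U₀) (y : Site (F.P n) 0) :
    HasFDerivAt (fun A : PBond (F.P K) 0 → Matrix (Fin 2) (Fin 2) ℂ => ((frameTwS F n K h U₀ A y : (Matrix (Fin 2) (Fin 2) ℂ)ˣ) : Matrix (Fin 2) (Fin 2) ℂ))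
      (fderiv ℂ (fun A : PBond (F.P K) 0 → Matrix (Fin 2) (Fin 2) ℂ => ((frameTwS F n K h U₀ A y : (Matrix (Fin 2) (Fin 2) ℂ)ˣ) : Matrix (Fin 2) (Fin 2) ℂ)) 0) 0 := by
  have h0 : ∀ b : PBond (F.P K) 0, ‖(0 : PBond (F.P K) 0 → Matrix (Fin 2) (Fin 2) ℂ) b‖ ≤ 0 * eta F n K := fun b => by
    rw [Pi.zero_apply, norm_zero, zero_mul]
  exact ((analyticAt_frameTwS_of_regPr F h hε₀ le_rfl hε (by norm_num) U₀ hreg y h0).1).differentiableAt.hasFDerivAt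

/-- ★★★ **W4 — THE SUP ROW OF THE LINEARISED SYMMETRIC FRAMES: `‖r y A‖ ≤ (8∕R)·‖A‖`, `R = e·η`** — the twin of ✓`Prop7SymAvgTwFrameBound.norm_fderiv_frameTw_le_of_regPr`
for the frames of record (RULING g26-№12): at a printed-regular background with `10¹²L³ε₀ ≤ 1`, `0 < e`, `10⁹L²e ≤ 1`, the linearised accumulated symmetric frame
`r y = fderiv (A ↦ frameTwS U₀ A y) 0` has operator norm `≤ 8∕(e·η)` — Cauchy's bound `4M∕R` (✓`Prop7AnalyticRemainderInputs.norm_fderiv_le_of_bound`) for the analytic,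
`M = 2`-bounded map on the sup-ball of radius `R = e·η` (`‖w − 1‖ ≤ 30L(2e + 2700Lε₀) ≤ 1` there).  η-order: `C_r = 8∕(eη) ~ η⁻¹` (the (−1)-weight, as for (T)).
[cite: Balaban1985Averaging, (161)-(163) p.42, (97) p.32; Balaban1985Variational, (46) p.285] -/
theorem norm_fderiv_frameTwS_le_of_regPr {ε₀ e : ℝ} (hε₀ : 0 < ε₀) (he : 0 < e) (hε : 10 ^ 12 * (F.L : ℝ) ^ 3 * ε₀ ≤ 1) (he9 : 10 ^ 9 * (F.L : ℝ) ^ 2 * e ≤ 1)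
    (U₀ : GaugeField (F.P K) 0 (Matrix.specialUnitaryGroup (Fin 2) ℂ)) (hreg : RegPr F n K ε₀ U₀) (y : Site (F.P n) 0)
    (A : PBond (F.P K) 0 → Matrix (Fin 2) (Fin 2) ℂ) :
    ‖fderiv ℂ (fun A : PBond (F.P K) 0 → Matrix (Fin 2) (Fin 2) ℂ => ((frameTwS F n K h U₀ A y : (Matrix (Fin 2) (Fin 2) ℂ)ˣ) : Matrix (Fin 2) (Fin 2) ℂ)) 0 A‖
      ≤ 8 / (e * eta F n K) * ‖A‖ := by
  have hη0 : 0 < eta F n K := eta_pos F n K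
  set R : ℝ := e * eta F n K with hR
  have hR0 : 0 < R := by positivity
  have hL3 : 3 ≤ F.L := by obtain ⟨a, ha⟩ := F.hL.1; have := F.hL.2; omega
  have hL3r : (3 : ℝ) ≤ F.L := by exact_mod_cast hL3
  -- on the ball: analytic, and within `1` of `1`
  have hball : ∀ A₀ ∈ ball (0 : PBond (F.P K) 0 → Matrix (Fin 2) (Fin 2) ℂ) R,
      AnalyticAt ℂ (fun A : PBond (F.P K) 0 → Matrix (Fin 2) (Fin 2) ℂ => ((frameTwS F n K h U₀ A y : (Matrix (Fin 2) (Fin 2) ℂ)ˣ) : Matrix (Fin 2) (Fin 2) ℂ)) A₀ ∧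
        ‖((frameTwS F n K h U₀ A₀ y : (Matrix (Fin 2) (Fin 2) ℂ)ˣ) : Matrix (Fin 2) (Fin 2) ℂ) - 1‖ ≤ 30 * (F.L : ℝ) * (2 * e + 2700 * (F.L : ℝ) * ε₀) := by
    intro A₀ hA₀
    have hA : ∀ b, ‖A₀ b‖ ≤ e * eta F n K := fun b => (norm_le_pi_norm A₀ b).trans (mem_ball_zero_iff.1 hA₀).le
    exact analyticAt_frameTwS_of_regPr F h hε₀ he.le hε he9 U₀ hreg y hA
  have hdiff : DifferentiableOn ℂ (fun A : PBond (F.P K) 0 → Matrix (Fin 2) (Fin 2) ℂ =>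
      ((frameTwS F n K h U₀ A y : (Matrix (Fin 2) (Fin 2) ℂ)ˣ) : Matrix (Fin 2) (Fin 2) ℂ)) (ball (0 : PBond (F.P K) 0 → Matrix (Fin 2) (Fin 2) ℂ) R) :=
    fun A₀ hA₀ => (hball A₀ hA₀).1.differentiableAt.differentiableWithinAt
  have hsmall : 30 * (F.L : ℝ) * (2 * e + 2700 * (F.L : ℝ) * ε₀) ≤ 1 := by
    have hL1 : (1 : ℝ) ≤ F.L := by linarith
    have hL23 : (F.L : ℝ) ^ 2 ≤ (F.L : ℝ) ^ 3 := pow_le_pow_right₀ hL1 (by norm_num)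
    have hL12 : (F.L : ℝ) ≤ (F.L : ℝ) ^ 2 := by nlinarith
    have h1 : (F.L : ℝ) * e ≤ (F.L : ℝ) ^ 2 * e := mul_le_mul_of_nonneg_right hL12 he.le
    have h2 : (F.L : ℝ) ^ 2 * ε₀ ≤ (F.L : ℝ) ^ 3 * ε₀ := mul_le_mul_of_nonneg_right hL23 hε₀.le
    nlinarith
  have hbd : ∀ A₀ ∈ ball (0 : PBond (F.P K) 0 → Matrix (Fin 2) (Fin 2) ℂ) R,
      ‖((frameTwS F n K h U₀ A₀ y : (Matrix (Fin 2) (Fin 2) ℂ)ˣ) : Matrix (Fin 2) (Fin 2) ℂ)‖ ≤ 2 := by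
    intro A₀ hA₀
    have h1 := ((hball A₀ hA₀).2).trans hsmall
    calc ‖((frameTwS F n K h U₀ A₀ y : (Matrix (Fin 2) (Fin 2) ℂ)ˣ) : Matrix (Fin 2) (Fin 2) ℂ)‖
        = ‖(((frameTwS F n K h U₀ A₀ y : (Matrix (Fin 2) (Fin 2) ℂ)ˣ) : Matrix (Fin 2) (Fin 2) ℂ) - 1) + 1‖ := by rw [sub_add_cancel]
      _ ≤ ‖((frameTwS F n K h U₀ A₀ y : (Matrix (Fin 2) (Fin 2) ℂ)ˣ) : Matrix (Fin 2) (Fin 2) ℂ) - 1‖ + ‖(1 : Matrix (Fin 2) (Fin 2) ℂ)‖ := norm_add_le _ _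
      _ ≤ 1 + 1 := add_le_add h1 (by rw [norm_one])
      _ = 2 := by norm_num
  have hC := norm_fderiv_le_of_bound (Y := (0 : PBond (F.P K) 0 → Matrix (Fin 2) (Fin 2) ℂ)) hR0 hdiff hbd (by rw [norm_zero]; positivity)
  calc ‖fderiv ℂ (fun A : PBond (F.P K) 0 → Matrix (Fin 2) (Fin 2) ℂ => ((frameTwS F n K h U₀ A y : (Matrix (Fin 2) (Fin 2) ℂ)ˣ) : Matrix (Fin 2) (Fin 2) ℂ)) 0 A‖
      ≤ ‖fderiv ℂ (fun A : PBond (F.P K) 0 → Matrix (Fin 2) (Fin 2) ℂ => ((frameTwS F n K h U₀ A y : (Matrix (Fin 2) (Fin 2) ℂ)ˣ) : Matrix (Fin 2) (Fin 2) ℂ)) 0‖ * ‖A‖ :=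
        ContinuousLinearMap.le_opNorm _ _
    _ ≤ 4 * 2 / R * ‖A‖ := mul_le_mul_of_nonneg_right hC (norm_nonneg _)
    _ = 8 / (e * eta F n K) * ‖A‖ := by rw [hR]; norm_num

end T3

end Summit.QuantumFields.YangMills.Theorems.Prop7SymFrameBound

end
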